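import Literature.Barriers.CriticalPhenomena.PlaquetteWalkKissLoopJump
import HarnessLib

/-!
# Barrier catalogue (SAWScalingLimit): NO SEPARATOR KISS after the head plaquette of the end («NO SEPARATOR KISS»)

`Z → ∞` limit model of the printed Yang–Baxter weights [GlazmanManolescu2019, §1, eq. (1)]; TAIL LEMMA of the «RECTANGLE COEFFICIENT» line (b-engine-1 g25,
DESIGN-next-g25 §2bis), separator half, assembled from `PlaquetteWalkKissLoop` (transport), `…Separation` (the loop misses the rest of the drawing) and
`…Jump` (±1 across the chord).

★★★ `YBWalk.no_separator_kiss`: a Yang–Baxter walk that ENDS on a side of a plaquette `r = fc h` visited exactly once CANNOT later (at indices `h < ta < tb`)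
visit a plaquette twice in SEPARATOR fashion (second entry opposite to the first exit). Proof: the winding number of the kiss loop is one and the same at the
start mid-point, along the whole before-part (in particular at `ptIn h` inside `r` and at `ptOut (ta − 1)`), at the end mid-point (joined to `ptIn h` inside
`r̄` without meeting the loop) and along the after-part (`ptOut tb`); but between the inner corner `kLoff` of the kiss plaquette (joined to `ptOut (ta − 1)`
through the midpoint of the first entry side without meeting the loop) and `ptOut tb` it jumps by one — contradiction.
For the venture lane this kills, in CASE B of (R2) (CAR H: the head plaquette `r ∈ H₀ ∪ {τ*}` is first hit before the tail), every separator kiss of the tail;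
LOBE kisses (adjacent exit / re-entry) remain (DESIGN-next-g25 §2bis). [AhlforsCA1979, Ch. 4 §2.1] [CourantRobbins1958, Ch. V App. §2] [GlazmanManolescu2019 §1]
-/

noncomputable section

open Set Function Complex
open Literature.Topology.PlaneTopology

namespace Literature.Probability.RandomPlanarGeometry.SAW.YangBaxter

open private mem_segment_toC eq_of_mem_crossSeg eq_side_of_mem_crossSeg_arcSeg eq_face_of_mem_arcSeg eq_innerPt_of_mem_crossSeg_arcSeg
  arcSeg_disjoint_faceBox crossSeg_faceBox segment_subset_faceBox crossSeg_side_eq crossSeg_side_eq' lineMap_toC_add_sub_half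
  from Literature.Probability.RandomPlanarGeometry.YangBaxterSAWExcursionJordan

open private fc_fh fc_ne from Literature.Probability.RandomPlanarGeometry.YangBaxterSAWGeneralDomain

namespace YBWalk

variable {D : Set Face} {a z : MidEdge} {γ : YBWalk D a z} {ta tb : ℕ}

/-- Two lattice segments in one frame: common points give affine parameters. [folklore] -/
private theorem seg_meet_params' {b A B C E : ℤ × ℤ} {x : ℂ} (h1 : x ∈ segment ℝ (toC (b + A)) (toC (b + B)))
    (h2 : x ∈ segment ℝ (toC (b + C)) (toC (b + E))) :
    ∃ t t' : ℝ, 0 ≤ t ∧ t ≤ 1 ∧ 0 ≤ t' ∧ t' ≤ 1 ∧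
      (A.1 : ℝ) + t * ((B.1 : ℝ) - A.1) = C.1 + t' * ((E.1 : ℝ) - C.1) ∧
      (A.2 : ℝ) + t * ((B.2 : ℝ) - A.2) = C.2 + t' * ((E.2 : ℝ) - C.2) := by
  obtain ⟨t, h0, h1', hx, hy⟩ := mem_segment_toC h1
  obtain ⟨t', h0', h1'', hx', hy'⟩ := mem_segment_toC h2
  refine ⟨t, t', h0, h1', h0', h1'', ?_, ?_⟩
  · have := hx.symm.trans hx'; simp only [Prod.fst_add, Int.cast_add] at this; linarith
  · have := hy.symm.trans hy'; simp only [Prod.snd_add, Int.cast_add] at this; linarith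

/-- Coordinates (piece 1/4): the segment from the midpoint of the first entry side `s₁` to the inner corner between `s₁` and `s₃ = s₂.opp` misses the
first arc `s₁ → s₂`. [folklore] -/
private theorem corner_vs_arc (s₁ s₂ : Side) (h1 : s₂ ≠ s₁) (h2 : s₂ ≠ s₁.opp) {t t' : ℝ} (hu0 : 0 ≤ t')
    (ex : (s₁.offset.1 : ℝ) + t * (((s₁.inOff + s₂.opp.inOff - ((2 : ℤ), (2 : ℤ))).1 : ℝ) - s₁.offset.1) =
      s₁.inOff.1 + t' * ((s₂.inOff.1 : ℝ) - s₁.inOff.1))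
    (ey : (s₁.offset.2 : ℝ) + t * (((s₁.inOff + s₂.opp.inOff - ((2 : ℤ), (2 : ℤ))).2 : ℝ) - s₁.offset.2) =
      s₁.inOff.2 + t' * ((s₂.inOff.2 : ℝ) - s₁.inOff.2)) : False := by
  revert h1 h2 ex ey
  cases s₁ <;> cases s₂ <;> simp [Side.inOff, Side.offset, Side.nIn, Side.opp] <;> intros <;> linarith

/-- Coordinates (piece 2/4): the same segment misses the chord `s₃ → s₁`. [folklore] -/
private theorem corner_vs_chord (s₁ s₂ : Side) (h1 : s₂ ≠ s₁) (h2 : s₂ ≠ s₁.opp) {t t' : ℝ}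
    (ex : (s₁.offset.1 : ℝ) + t * (((s₁.inOff + s₂.opp.inOff - ((2 : ℤ), (2 : ℤ))).1 : ℝ) - s₁.offset.1) =
      s₂.opp.inOff.1 + t' * ((s₁.inOff.1 : ℝ) - s₂.opp.inOff.1))
    (ey : (s₁.offset.2 : ℝ) + t * (((s₁.inOff + s₂.opp.inOff - ((2 : ℤ), (2 : ℤ))).2 : ℝ) - s₁.offset.2) =
      s₂.opp.inOff.2 + t' * ((s₁.inOff.2 : ℝ) - s₂.opp.inOff.2)) : False := by
  revert h1 h2 ex ey
  cases s₁ <;> cases s₂ <;> simp [Side.inOff, Side.offset, Side.nIn, Side.opp] <;> intros <;> linarith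

/-- Coordinates (piece 3/4): the same segment misses the crossing segment of the exit side `s₂`. [folklore] -/
private theorem corner_vs_cross₂ (s₁ s₂ : Side) (h1 : s₂ ≠ s₁) (h2 : s₂ ≠ s₁.opp) {t t' : ℝ} (ht0 : 0 ≤ t) (ht1 : t ≤ 1) (hu0 : 0 ≤ t')
    (ex : (s₁.offset.1 : ℝ) + t * (((s₁.inOff + s₂.opp.inOff - ((2 : ℤ), (2 : ℤ))).1 : ℝ) - s₁.offset.1) =
      s₂.inOff.1 + t' * (((s₂.offset - s₂.nIn).1 : ℝ) - s₂.inOff.1))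
    (ey : (s₁.offset.2 : ℝ) + t * (((s₁.inOff + s₂.opp.inOff - ((2 : ℤ), (2 : ℤ))).2 : ℝ) - s₁.offset.2) =
      s₂.inOff.2 + t' * (((s₂.offset - s₂.nIn).2 : ℝ) - s₂.inOff.2)) : False := by
  revert h1 h2 ex ey
  cases s₁ <;> cases s₂ <;> simp [Side.inOff, Side.offset, Side.nIn, Side.opp] <;> intros <;> linarith

/-- Coordinates (piece 4/4): the same segment misses the crossing segment of the re-entry side `s₃ = s₂.opp`. [folklore] -/
private theorem corner_vs_cross₃ (s₁ s₂ : Side) (h1 : s₂ ≠ s₁) (h2 : s₂ ≠ s₁.opp) {t t' : ℝ} (ht1 : t ≤ 1)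
    (ex : (s₁.offset.1 : ℝ) + t * (((s₁.inOff + s₂.opp.inOff - ((2 : ℤ), (2 : ℤ))).1 : ℝ) - s₁.offset.1) =
      s₂.opp.inOff.1 + t' * (((s₂.opp.offset - s₂.opp.nIn).1 : ℝ) - s₂.opp.inOff.1))
    (ey : (s₁.offset.2 : ℝ) + t * (((s₁.inOff + s₂.opp.inOff - ((2 : ℤ), (2 : ℤ))).2 : ℝ) - s₁.offset.2) =
      s₂.opp.inOff.2 + t' * (((s₂.opp.offset - s₂.opp.nIn).2 : ℝ) - s₂.opp.inOff.2)) : False := by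
  revert h1 h2 ex ey
  cases s₁ <;> cases s₂ <;> simp [Side.inOff, Side.offset, Side.nIn, Side.opp] <;> intros <;> linarith

/-! ## §1 From the head plaquette of the end to the end mid-point -/

/-- ★ **Inside the plaquette of the end**: if the walk ends on the side `s` of a plaquette `r = fc h` visited exactly once, with `h < ta`, then the kiss loop's
winding number at `ptIn h` equals its value at the end mid-point `midPt z` (the segment `innerPt r (sIn h) → innerPt r s` and the inner half-crossing
`innerPt r s → midPt z` miss the loop: `r` is not a loop plaquette, `nth h` and `nth n = z` are not loop edges).
[cite: AhlforsCA1979, Ch. 4 §2.1] [cite: CourantRobbins1958, Ch. V Appendix §2 (polygons)] -/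
theorem windK_ptIn_head_eq_end (hab : ta < tb) (htb : tb < γ.arcs.length) (hkiss : γ.fc tb = γ.fc ta) {h : ℕ} (hh : h < ta) {s : Side}
    (hz : z = (γ.fc h).side s) (hvis : ∀ j < γ.arcs.length, γ.fc j = γ.fc h → j = h) :
    γ.windK ta tb (toC (γ.ptIn h)) = γ.windK ta tb (toC (midPt z)) := by
  have hn : h < γ.arcs.length := by omega
  obtain ⟨hin, -, -⟩ := γ.side_sIn_nth hn
  -- (a) along the «arc segment» of `r` from the entry inner point to the inner point of the end side
  have h1 : γ.windK ta tb (toC (γ.ptIn h)) = γ.windK ta tb (toC (innerPt (γ.fc h) s)) := by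
    refine windK_eq_of_segment fun x hx k hk hxk => ?_
    have hxa : x ∈ arcSeg (γ.fc h) (γ.sIn h) s := by rw [arcSeg, ← YBWalk.ptIn]; exact hx
    rcases mem_kEdge_cases hab htb hkiss hk hxk with ⟨i, hi, ha⟩ | ⟨i, hi, hc⟩ | hch
    · have hF := eq_face_of_mem_arcSeg hxa ha
      have := hvis (ta + i) (by omega) hF.symm; omega
    · rcases eq_side_of_mem_crossSeg_arcSeg hc hxa with e | e
      · rw [hin] at e; have := γ.nth_inj (by omega) (by omega) e; omega
      · have e' : γ.nth (ta + i + 1) = γ.nth γ.arcs.length := e.trans (by rw [γ.nth_length]; exact hz.symm)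
        have := γ.nth_inj (by omega) le_rfl e'; omega
    · have hF := eq_face_of_mem_arcSeg hxa hch
      have := hvis ta (by omega) hF.symm; omega
  -- (b) along the inner half of the crossing segment of the end side
  have h2 : γ.windK ta tb (toC (innerPt (γ.fc h) s)) = γ.windK ta tb (toC (midPt z)) := by
    refine windK_eq_of_segment fun x hx k hk hxk => ?_
    have hsub : segment ℝ (toC (innerPt (γ.fc h) s)) (toC (midPt z)) ⊆ crossSeg (γ.nth γ.arcs.length) := by
      have ez : γ.nth γ.arcs.length = (γ.fc h).side s := by rw [γ.nth_length]; exact hz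
      rw [ez, congrArg midPt hz, crossSeg_side_eq, innerPt_eq]
      refine (convex_segment _ _).segment_subset (left_mem_segment _ _ _) ?_
      rw [segment_eq_image_lineMap]
      exact ⟨1 / 2, ⟨by norm_num, by norm_num⟩, lineMap_toC_add_sub_half _ _⟩
    exact crossSeg_disjoint_kEdge_of_gt hab htb hkiss (j := γ.arcs.length) (by omega) le_rfl hk (hsub hx) hxk
  rw [h1, h2]

/-! ## §2 From the last before-point to the inner corner of the kiss plaquette -/

/-- ★ **Into the kiss plaquette from the before-side**: for a separator kiss with `1 ≤ ta`, the kiss loop's winding number at `ptOut (ta − 1)` equals its value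
at the inner corner `(fc ta).base + kLoff` (through the midpoint of the first entry side: the outer half-crossing and the segment from the side midpoint to
the corner miss the loop — the first arc and the chord meet the entry side's crossing segment only at `ptIn ta`).
[cite: AhlforsCA1979, Ch. 4 §2.1] [cite: CourantRobbins1958, Ch. V Appendix §2 (polygons)] [cite: GlazmanManolescu2019, §1, Fig. 1] -/
theorem windK_ptOut_pred_eq_corner (hab : ta < tb) (htb : tb < γ.arcs.length) (hkiss : γ.fc tb = γ.fc ta) (h1 : 1 ≤ ta)
    (hsep : γ.sIn tb = (γ.sOut ta).opp) :
    γ.windK ta tb (toC (γ.ptOut (ta - 1))) = γ.windK ta tb (toC ((γ.fc ta).base + γ.kLoff ta tb)) := by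
  have hta : ta < γ.arcs.length := by omega
  obtain ⟨hs21, hs21', hs4⟩ := separator_sides hta htb (by omega) hkiss hsep
  set b := (γ.fc ta).base with hb
  obtain ⟨hin, hout, -⟩ := γ.side_sIn_nth hta
  obtain ⟨-, houtp, -⟩ := γ.side_sIn_nth (i := ta - 1) (by omega)
  rw [show ta - 1 + 1 = ta by omega] at houtp
  obtain ⟨hinb, houtb, -⟩ := γ.side_sIn_nth htb
  rw [hkiss] at hinb houtb
  -- the midpoint of the first entry side and the two pieces of the path
  have hface : γ.fc (ta - 1) ≠ γ.fc ta := by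
    have := γ.fc_succ_ne (i := ta - 1) (by omega); rwa [show ta - 1 + 1 = ta by omega] at this
  have hnIn' : (γ.sIn ta).nIn = -(γ.sOut (ta - 1)).nIn := nIn_eq_neg_of_side_eq (houtp.trans hin.symm) hface
  have hnIn : (γ.sOut (ta - 1)).nIn = -(γ.sIn ta).nIn := by rw [hnIn', neg_neg]
  have eM : midPt (γ.nth ta) = b + (γ.sIn ta).offset := by rw [← hin, midPt_side]
  have ePout : γ.ptOut (ta - 1) = b + ((γ.sIn ta).offset - (γ.sIn ta).nIn) := by
    rw [YBWalk.ptOut, innerPt_eq, houtp, hnIn, ← hin, midPt_side, hb]; abel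
  -- a point on a loop edge inside the closed kiss plaquette lies on the first arc, the chord, or the crossings at `s₂` / `s₃`
  have hloc : ∀ k, k < kN ta tb → ∀ x ∈ γ.kEdge ta tb k, x ∈ faceBox (γ.fc ta) →
      x ∈ segment ℝ (toC (b + (γ.sIn ta).inOff)) (toC (b + (γ.sOut ta).inOff)) ∨
      x ∈ segment ℝ (toC (b + (γ.sIn tb).inOff)) (toC (b + (γ.sIn ta).inOff)) ∨
      x ∈ segment ℝ (toC (b + (γ.sOut ta).inOff)) (toC (b + ((γ.sOut ta).offset - (γ.sOut ta).nIn))) ∨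
      x ∈ segment ℝ (toC (b + (γ.sIn tb).inOff)) (toC (b + ((γ.sIn tb).offset - (γ.sIn tb).nIn))) := by
    intro k hk x hxk hxb
    rcases mem_kEdge_cases hab htb hkiss hk hxk with ⟨i, hi, ha⟩ | ⟨i, hi, hc⟩ | hch
    · by_cases hF : γ.fc (ta + i) = γ.fc ta
      · have hi0 : i = 0 := by
          by_contra hne
          obtain ⟨-, e1, e2, -, -⟩ := γ.not_straight_of_two_arcs hta (show ta + i < γ.arcs.length by omega) (by omega) hF
          obtain ⟨-, e1', e2', -, -⟩ := γ.not_straight_of_two_arcs htb (show ta + i < γ.arcs.length by omega) (by omega) (hF.trans hkiss.symm)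
          rcases side_mem_of_kiss hta htb (by omega) hkiss (γ.sIn (ta + i)) with e | e | e | e
          · exact e1 e
          · exact e2 e
          · exact e1' e
          · exact e2' e
        subst hi0
        left; rw [Nat.add_zero, arcSeg] at ha; exact ha
      · exact absurd hxb (fun hb' => arcSeg_disjoint_faceBox hF ha hb')
    · obtain ⟨s, hs⟩ := crossSeg_faceBox hc hxb
      have hm : ta + i + 1 = ta + 1 ∨ ta + i + 1 = tb := by
        rcases side_mem_of_kiss hta htb (by omega) hkiss s with e | e | e | e
        · rw [e, hin] at hs; have := γ.nth_inj (by omega) (by omega) hs; omega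
        · rw [e, hout] at hs; have := γ.nth_inj (by omega) (by omega) hs; omega
        · rw [e, hinb] at hs; have := γ.nth_inj (by omega) (by omega) hs; omega
        · rw [e, houtb] at hs; have := γ.nth_inj (by omega) (by omega) hs; omega
      rcases hm with e | e
      · right; right; left; rw [e, ← hout, crossSeg_side_eq'] at hc; exact hc
      · right; right; right; rw [e, ← hinb, crossSeg_side_eq'] at hc; exact hc
    · right; left; rw [arcSeg] at hch; exact hch
  -- (a) the outer half-crossing `ptOut (ta-1) → midPt (nth ta)`
  have hA : γ.windK ta tb (toC (γ.ptOut (ta - 1))) = γ.windK ta tb (toC (midPt (γ.nth ta))) := by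
    refine windK_eq_of_segment fun x hx k hk hxk => ?_
    rw [ePout, eM] at hx
    -- the outer half lies on `crossSeg (nth ta)` and in the closed neighbour… we only need: a loop point on it lies in the closed kiss plaquette only at
    -- the side midpoint line; use the crossing-segment incidences directly
    have hxc : x ∈ crossSeg (γ.nth ta) := by
      rw [← hin, crossSeg_side_eq', segment_symm]
      rw [hb] at hx
      refine (convex_segment _ _).segment_subset (left_mem_segment _ _ _) ?_ hx
      rw [segment_eq_image_lineMap]
      refine ⟨1 / 2, ⟨by norm_num, by norm_num⟩, ?_⟩
      rw [show (γ.fc ta).base + ((γ.sIn ta).offset - (γ.sIn ta).nIn) = ((γ.fc ta).base + (γ.sIn ta).offset) + (-(γ.sIn ta).nIn) by abel,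
        show (γ.fc ta).base + (γ.sIn ta).inOff = ((γ.fc ta).base + (γ.sIn ta).offset) - (-(γ.sIn ta).nIn) by rw [Side.inOff]; abel]
      exact lineMap_toC_add_sub_half _ _
    rcases mem_kEdge_cases hab htb hkiss hk hxk with ⟨i, hi, ha⟩ | ⟨i, hi, hc⟩ | hch
    · obtain ⟨e1, e2, -⟩ := γ.side_sIn_nth (show ta + i < γ.arcs.length by omega)
      rcases eq_side_of_mem_crossSeg_arcSeg hxc ha with e | e
      · -- the crossed side is the entry side of the loop arc `ta + i`: only `i = 0`, and then the common point is `ptIn ta`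
        rw [e1] at e; have := γ.nth_inj (by omega) (by omega) e
        have hi0 : i = 0 := by omega
        subst hi0
        rw [Nat.add_zero] at ha
        have hpt := eq_innerPt_of_mem_crossSeg_arcSeg (γ.side_sIn_nth hta).2.2 (by rw [hin]; exact hxc) ha
        rw [hpt, innerPt] at hx
        obtain ⟨t, t', h0, h1', h0', h1'', ex, ey⟩ := seg_meet_params' hx (left_mem_segment ℝ (toC (b + (γ.sIn ta).inOff)) (toC (b + (γ.sIn ta).inOff)))
        cases hs : γ.sIn ta <;> simp only [hs, Side.inOff, Side.offset, Side.nIn, Prod.fst_add, Prod.snd_add, Prod.fst_sub, Prod.snd_sub,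
          Int.cast_add, Int.cast_sub, Int.cast_neg, Int.cast_ofNat, Int.cast_one, Int.cast_zero] at ex ey <;> linarith
      · rw [e2] at e; have := γ.nth_inj (by omega) (by omega) e; omega
    · have := γ.nth_inj (by omega) (by omega) (eq_of_mem_crossSeg hxc hc); omega
    · -- the chord meets `crossSeg (nth ta)` only at `ptIn ta`
      have hch' : x ∈ arcSeg (γ.fc ta) (γ.sIn ta) (γ.sIn tb) := by rw [arcSeg, segment_symm]; exact hch
      obtain ⟨-, e1, -, -, -⟩ := γ.not_straight_of_two_arcs hta htb (by omega) hkiss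
      have hpt := eq_innerPt_of_mem_crossSeg_arcSeg (Ne.symm e1) (by rw [hin]; exact hxc) hch'
      rw [hpt, innerPt] at hx
      obtain ⟨t, t', h0, h1', h0', h1'', ex, ey⟩ := seg_meet_params' hx (left_mem_segment ℝ (toC (b + (γ.sIn ta).inOff)) (toC (b + (γ.sIn ta).inOff)))
      cases hs : γ.sIn ta <;> simp only [hs, Side.inOff, Side.offset, Side.nIn, Prod.fst_add, Prod.snd_add, Prod.fst_sub, Prod.snd_sub,
        Int.cast_add, Int.cast_sub, Int.cast_neg, Int.cast_ofNat, Int.cast_one, Int.cast_zero] at ex ey <;> linarith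
  -- (b) from the side midpoint to the inner corner, inside the closed kiss plaquette
  have hB : γ.windK ta tb (toC (midPt (γ.nth ta))) = γ.windK ta tb (toC (b + γ.kLoff ta tb)) := by
    refine windK_eq_of_segment fun x hx k hk hxk => ?_
    rw [eM] at hx
    have hObd : ∀ s : Side, 0 ≤ s.offset.1 ∧ s.offset.1 ≤ 4 ∧ 0 ≤ s.offset.2 ∧ s.offset.2 ≤ 4 := by decide
    have hVbd : ∀ s₁ s₃ : Side, 0 ≤ (s₁.inOff + s₃.inOff - ((2 : ℤ), (2 : ℤ))).1 ∧ (s₁.inOff + s₃.inOff - ((2 : ℤ), (2 : ℤ))).1 ≤ 4 ∧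
        0 ≤ (s₁.inOff + s₃.inOff - ((2 : ℤ), (2 : ℤ))).2 ∧ (s₁.inOff + s₃.inOff - ((2 : ℤ), (2 : ℤ))).2 ≤ 4 := by decide
    have hxb : x ∈ faceBox (γ.fc ta) := segment_subset_faceBox _ (hObd _) (hVbd _ _) hx
    rcases hloc k hk x hxk hxb with hp | hp | hp | hp
    · obtain ⟨t, t', -, -, h0', -, ex, ey⟩ := seg_meet_params' hx hp
      unfold kLoff at ex ey; rw [hsep] at ex ey
      exact corner_vs_arc _ _ hs21 hs21' h0' ex ey
    · obtain ⟨t, t', -, -, -, -, ex, ey⟩ := seg_meet_params' hx hp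
      unfold kLoff at ex ey; rw [hsep] at ex ey
      exact corner_vs_chord _ _ hs21 hs21' ex ey
    · obtain ⟨t, t', h0, h1', h0', -, ex, ey⟩ := seg_meet_params' hx hp
      unfold kLoff at ex ey; rw [hsep] at ex ey
      exact corner_vs_cross₂ _ _ hs21 hs21' h0 h1' h0' ex ey
    · obtain ⟨t, t', -, h1', -, -, ex, ey⟩ := seg_meet_params' hx hp
      unfold kLoff at ex ey; rw [hsep] at ex ey
      exact corner_vs_cross₃ _ _ hs21 hs21' h1' ex ey
  rw [hA, hB]

/-! ## §3 No separator kiss -/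

/-- ★★★ **NO SEPARATOR KISS AFTER THE HEAD PLAQUETTE OF THE END.** A Yang–Baxter walk ending on a side of a plaquette `fc h` that it visits exactly once cannot, at
indices `h < ta < tb`, cross one plaquette twice with the second entry opposite to the first exit. [cite: AhlforsCA1979, Ch. 4 §2.1 (index of a point with respect
to a closed curve)] [cite: CourantRobbins1958, Ch. V Appendix §2 (The Jordan Curve Theorem for Polygons)] [cite: GlazmanManolescu2019, §1, Fig. 1 and eq. (1)] -/
theorem no_separator_kiss (hab : ta < tb) (htb : tb < γ.arcs.length) (hkiss : γ.fc tb = γ.fc ta) (hsep : γ.sIn tb = (γ.sOut ta).opp)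
    {h : ℕ} (hh : h < ta) {s : Side} (hz : z = (γ.fc h).side s) (hvis : ∀ j < γ.arcs.length, γ.fc j = γ.fc h → j = h) : False := by
  have e1 := (windK_before hab htb hkiss h hh).1                       -- ptIn h ↦ midPt a
  have e2 := (windK_before hab htb hkiss (ta - 1) (by omega)).2         -- ptOut (ta-1) ↦ midPt a
  have e3 := windK_ptIn_head_eq_end hab htb hkiss hh hz hvis            -- ptIn h ↦ midPt z
  have e4 := windK_end hab htb hkiss                                    -- midPt z ↦ ptOut tb
  have e5 := windK_ptOut_pred_eq_corner hab htb hkiss (by omega) hsep   -- ptOut (ta-1) ↦ corner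
  rcases windK_jump_separator hab htb hkiss hsep with e | e <;> omega

end YBWalk

namespace ΩG

variable {D : Set Face} {a : MidEdge} {r : Face} {ω : ΩG D a r}

/-- ★★★ **NO SEPARATOR KISS AFTER THE FIRST HIT (class `B2a`).** In a class-`B2a` walk (the rooted rhombus `r` carries exactly one arc, the first hit, and the
walk returns to a side of `r` at its end), two arcs `firstHitG < ta < tb` in one plaquette never form a SEPARATOR kiss: the second entry side is not opposite
to the first exit side. (So every plaquette visited twice after the first hit is a LOBE: the loop between the two visits leaves and re-enters through
adjacent sides.) [cite: GlazmanManolescu2019, §1, Fig. 1 and eq. (1); Lemma 2.1 (grouping by the first rhombus hit)]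
[cite: AhlforsCA1979, Ch. 4 §2.1] [cite: CourantRobbins1958, Ch. V Appendix §2] -/
theorem no_separator_kiss_after_firstHit (hr : RootedFace D a r) (h : ω.IsB2a) {ta tb : ℕ} (hfh : ω.2.firstHitG < ta)
    (hab : ta < tb) (htb : tb < ω.2.arcs.length) (hkiss : ω.2.fc tb = ω.2.fc ta) : ω.2.sIn tb ≠ (ω.2.sOut ta).opp := by
  intro hsep
  obtain ⟨hfc, -, -⟩ := fc_fh ω hr h
  refine YBWalk.no_separator_kiss hab htb hkiss hsep hfh (s := ω.1) (by rw [hfc]) ?_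
  intro j hj he
  rw [hfc] at he
  by_contra hne
  rcases lt_or_gt_of_ne hne with hlt | hgt
  · have hface := (YBWalk.arcFace_arcAt hj).1
    rw [YBWalk.arcAt_eq hj, he, ← ω.2.nth_eq_getElem, ← ω.2.nth_eq_getElem] at hface
    exact ω.2.arcFace_ne_of_lt_firstHitG hlt hj hface
  · exact fc_ne ω hr h hgt hj he

end ΩG

end Literature.Probability.RandomPlanarGeometry.SAW.YangBaxter
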